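/-
Origin: written from primary sources — Y. Liu, Camb. J. Math. 9 (2021), proof of Thm. 4.15 (arXiv:2102.11518 `FJcycle.tex`
l. 2193–2212: restriction of theta functions along `U(V⋆) × U(V⋆^⊥) ↪ U(V)`, «`V(μ,e)|_ι ⊆ V⋆(μ,e) ⊗ C([U(V⋆^⊥)])`»);
S. Kudla, *Seesaw dual reductive pairs* (1984) §1; P. Fleig, H. Gustafsson, A. Kleinschmidt, D. Persson, *Eisenstein Series and
Automorphic Representations* (2018) §12.3 (12.37)–(12.38) (theta lift as a kernel integral). Adapted: no. This file is the
FUNCTION-LEVEL sequel of `UnitaryDualPairSeesawCharacterLeft` (Weil-operator / theta-FUNCTIONAL level): it reads A-p09's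
`thetaDistLM_omega_seesawBigLeft_sumTensor` on the three CONSTRUCTED theta-kernel data of `UnitaryDualPairThetaKernel` and then
under the integral sign of `Weil1964.ThetaLift`. Kernel only; no records; the compatibility of the three splittings and the
triviality of the see-saw character are hypotheses, never asserted.
-/
import Literature.NumberTheory.GelbartRogawski1991.UnitaryDualPairSeesawCharacterLeft
import Literature.NumberTheory.GelbartRogawski1991.UnitaryDualPairThetaKernel
import Literature.NumberTheory.Weil1964.ThetaLift
import HarnessLib

-- buildfix G11b-3 recipe (as in `UnitaryDualPairSeesawCharacterLeft`): elaborate sequentially.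
set_option Elab.async false

/-!
# The V-side see-saw at the level of theta KERNELS and theta LIFTS: every `U(J₂)(𝔸)`-slice of the restricted big theta lift is a
# small-pair theta lift with a twisted weight ([Liu2021] proof of Thm. 4.15, «`V(μ,e)|_ι ⊆ V⋆(μ,e) ⊗ C([U(V⋆^⊥)])`»)

Topic `NumberTheory/GelbartRogawski1991`; namespace `Literature.NumberTheory.GelbartRogawski1991.UnitaryDualPair`.  THEOREMS ONLY
(no definition, no named fact, no instance; net Literature debt 0).  Cell `hodgecm-mathlib` (D-0151), fan B-III line (T2)
`LIU415-SPEC` ([Liu2021] Thm. 4.15), stub S2 «theta restricts to theta», piece **(g2)** (A-plan1 g6 13:31:24Z: A-p08 owner, A-p09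
lead, A-p03 second): the generator identity at FUNCTION level that feeds A-p03's span reduction (g1)
`ThetaKernelDatum.thetaForms_map_le_iff` (`ThetaClassRestriction`) and S2e (A) `WeightForms.image_thetaClasses_subset_of_map_le`.

SETTING = that of `UnitaryDualPairSeesawCharacterLeft` (`E/F`, `c`, `δ`, Gram data `J₁, J₂, J_W` over `T₁, T₂, T_W`, enumerations
`e_V, e₁, e₂`, three COMPATIBLE pair splittings `s, s₁, s₂`, hypotheses `hs hs₁ hs₂`) PLUS the inputs of the three CONSTRUCTED
theta-kernel data of `UnitaryDualPairThetaKernel` — Weil's majorants `hρ hρ₁ hρ₂` and stable index sets `SK SK₁ SK₂` — for the big pair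
`(U(J₁ ⊕ᶠ J₂), U(J_W))` (`M`, Schwartz space `𝒮(𝔸^{Fin n})`, `n = (N₁+N₂)M` via `e_V`) and the two small pairs `(U(J_j), U(J_W))`
(`M_j`, `𝒮(𝔸^{Fin n_j})` via `e_j`).  The test vector is the pure tensor READ IN THE BIG DATUM'S COORDINATES:
`Φ := R_{e_V} (R_{e_Σ}⁻¹ (R_{e₁}⁻¹ Φ₁ ⊠ R_{e₂}⁻¹ Φ₂)) = piSBReindex e_V (sumTensor e_Σ ((piSBReindex e₁).symm Φ₁) ((piSBReindex e₂).symm Φ₂))`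
for `Φ_j ∈ 𝒮(𝔸^{Fin n_j})`, `e_Σ = (finSumFinEquiv × 1)⁻¹ ≫ sumProdDistrib`.

* §1 three reindex junctions (`thetaDistLM_omega_seesawSmallLeft₁_symm`, `…₂_symm`, `thetaDistLM_omega_pairSplitting_blockDiag_piSBReindex`):
  the Kronecker-coordinate see-saw splittings of `UnitaryDualPairSeesawCharacterLeft` against the `Fin n`-coordinate pair splittings
  of the data (`omega_seesaw…_apply` + `thetaDistLM_piSBReindex`);
* §2 **KERNEL LEVEL** `thetaDistLM_omega_pairSplitting_blockDiag_sumTensor` / `thetaFun_blockDiag_sumTensor`: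
  `θ_Φ(g₁ ⊕ g₂, y) = χ((g₁⁻¹,g₂⁻¹),y⁻¹) · θ¹_{Φ₁}(g₁, y) · θ²_{Φ₂}(g₂, y)` on `U(J₁)(𝔸) × U(J₂)(𝔸) × U(J_W)(𝔸)`
  (`M.thetaFun`, `θ_Φ(x,h) = Θ(ω(s_pair(x⁻¹,h⁻¹))Φ)` — [Liu2021] display l. 2204–2208 with ONE term, the see-saw character explicit);
* §3 **LIFT LEVEL** `thetaLiftFun_blockDiag_sumTensor`: with the see-saw character trivial (`hχ` — B-p08's renormalisation (c2)),
  `Θ̃_Φ(f)(g₁ ⊕ g₂) = Θ̃¹_{Φ₁}(f · θ²_{Φ₂}(g₂⁻¹ΓU₂, ·))(g₁)` for every weight `f ∈ C([U(J_W)], ℂ)`: the `g₂`-slice of the restricted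
  big theta lift IS the small theta lift of `Φ₁` against the `g₂`-twisted weight (`ThetaKernelDatum.thetaLiftFun`, `thetaLift_apply`,
  `integral_congr_ae`) — «`V(μ,e)|_ι ⊆ V⋆(μ,e) ⊗ C([U(V⋆^⊥)])`» read slice-wise.

What this file does NOT do: the weight-FORM packaging (`thetaForm`, `restrictHom J`, K-types along the block diagonal — the (g1)
layer over `thetaForms_map_le_iff`), the identification of `χ` (S2c), the test-vector decomposition (S2d), the (S) split of a3_liu418.
HC_CM is proved only modulo the 7 printed citations until rung 0 closes; this file discharges nothing by itself.
-/

set_option autoImplicit false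

noncomputable section

open scoped Matrix Kronecker TensorProduct
open _root_.MeasureTheory NumberField
open Literature.NumberTheory.Automorphic Literature.NumberTheory.Automorphic.UnitaryGroup
open Literature.NumberTheory.Weil1964 Literature.RepresentationTheory.HeisenbergGroup

namespace Literature.NumberTheory.GelbartRogawski1991

namespace UnitaryDualPair

variable (F E : Type) [Field F] [NumberField F] [Field E] [NumberField E] [Algebra F E]
variable (c : E ≃ₐ[F] E) (N₁ N₂ M : ℕ) {n n₁ n₂ : ℕ}
  (eV : Fin (N₁ + N₂) × Fin M ≃ Fin n) (e₁ : Fin N₁ × Fin M ≃ Fin n₁) (e₂ : Fin N₂ × Fin M ≃ Fin n₂)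
variable (J₁ : Matrix (Fin N₁) (Fin N₁) E) (J₂ : Matrix (Fin N₂) (Fin N₂) E) (JW : Matrix (Fin M) (Fin M) E)
variable {T₁ : Matrix (Fin N₁) (Fin N₁) F} {T₂ : Matrix (Fin N₂) (Fin N₂) F} {TW : Matrix (Fin M) (Fin M) F}
variable [Algebra.IsQuadraticExtension F E] {δ : E} (hcδ : c δ = -δ) (hδ : δ ≠ 0) {d : F}
  (hd : δ * δ = algebraMap F E d) (h₁ : T₁.IsSymm) (h₂ : T₂.IsSymm) (hW : TW.IsSymm) (h₁d : IsUnit T₁.det)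
  (h₂d : IsUnit T₂.det) (hWd : IsUnit TW.det) (hVd : IsUnit (finSum N₁ N₂ T₁ T₂).det)
  (hJ₁ : J₁ = T₁.map (algebraMap F E)) (hJ₂ : J₂ = T₂.map (algebraMap F E)) (hJW : JW = TW.map (algebraMap F E))
variable {s : adelicPair F E c (N₁ + N₂) M (finSum N₁ N₂ J₁ J₂) JW →*
    adelicMpCont F (Fin n) (adelicGram F eV (finSum N₁ N₂ T₁ T₂) TW)}
  {s₁ : adelicPair F E c N₁ M J₁ JW →* adelicMpCont F (Fin n₁) (adelicGram F e₁ T₁ TW)}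
  {s₂ : adelicPair F E c N₂ M J₂ JW →* adelicMpCont F (Fin n₂) (adelicGram F e₂ T₂ TW)}
variable [LocallyCompactSpace (adelic F E c (N₁ + N₂) (finSum N₁ N₂ J₁ J₂))] [LocallyCompactSpace (adelic F E c N₁ J₁)]
  [LocallyCompactSpace (adelic F E c N₂ J₂)] [LocallyCompactSpace (adelic F E c M JW)]
variable
  (hs : (splittingDatum F E c (N₁ + N₂) M eV (finSum N₁ N₂ J₁ J₂) JW hcδ hδ hd (isSymm_finSum h₁ h₂) hW hVd hWd
    (finSum_eq_map_finSum F E N₁ N₂ J₁ J₂ hJ₁ hJ₂) hJW).IsCompatible s)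
  (hs₁ : (splittingDatum F E c N₁ M e₁ J₁ JW hcδ hδ hd h₁ hW h₁d hWd hJ₁ hJW).IsCompatible s₁)
  (hs₂ : (splittingDatum F E c N₂ M e₂ J₂ JW hcδ hδ hd h₂ hW h₂d hWd hJ₂ hJW).IsCompatible s₂)
  -- Weil's majorants and the index sets of the three theta-kernel data
  (hρ : HasThetaMajorants fun (p : adelic F E c (N₁ + N₂) (finSum N₁ N₂ J₁ J₂) × adelic F E c M JW)
    (Φ : piSchwartzBruhat F (Fin n)) => pairRep F E c (N₁ + N₂) M eV (finSum N₁ N₂ J₁ J₂) JW s p Φ)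
  (SK : Set (piSchwartzBruhat F (Fin n)))
  (hSK : ∀ (h : adelic F E c M JW) (Φ : piSchwartzBruhat F (Fin n)), Φ ∈ SK →
    pairRep F E c (N₁ + N₂) M eV (finSum N₁ N₂ J₁ J₂) JW s (1, h) Φ ∈ SK)
  (hρ₁ : HasThetaMajorants fun (p : adelic F E c N₁ J₁ × adelic F E c M JW) (Φ : piSchwartzBruhat F (Fin n₁)) =>
    pairRep F E c N₁ M e₁ J₁ JW s₁ p Φ)
  (SK₁ : Set (piSchwartzBruhat F (Fin n₁)))
  (hSK₁ : ∀ (h : adelic F E c M JW) (Φ : piSchwartzBruhat F (Fin n₁)), Φ ∈ SK₁ → pairRep F E c N₁ M e₁ J₁ JW s₁ (1, h) Φ ∈ SK₁)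
  (hρ₂ : HasThetaMajorants fun (p : adelic F E c N₂ J₂ × adelic F E c M JW) (Φ : piSchwartzBruhat F (Fin n₂)) =>
    pairRep F E c N₂ M e₂ J₂ JW s₂ p Φ)
  (SK₂ : Set (piSchwartzBruhat F (Fin n₂)))
  (hSK₂ : ∀ (h : adelic F E c M JW) (Φ : piSchwartzBruhat F (Fin n₂)), Φ ∈ SK₂ → pairRep F E c N₂ M e₂ J₂ JW s₂ (1, h) Φ ∈ SK₂)

/-! ## §1 Reindex junctions: Kronecker-coordinate see-saw splittings vs the `Fin n`-coordinate pair splittings of the data -/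

omit [Algebra.IsQuadraticExtension F E] [LocallyCompactSpace (adelic F E c (N₁ + N₂) (finSum N₁ N₂ J₁ J₂))]
  [LocallyCompactSpace (adelic F E c N₁ J₁)] [LocallyCompactSpace (adelic F E c N₂ J₂)]
  [LocallyCompactSpace (adelic F E c M JW)] in
set_option maxHeartbeats 1600000 in
/-- **small side 1 read through `e₁`**: `Θ_{κ₁}(ω(seesawSmallLeft₁ s₁ p)(R_{e₁}⁻¹Φ₁)) = Θ_{n₁}(ω(s_{1,pair}(p.1.1, p.2)) Φ₁)`
(`omega_seesawSmallLeft₁_apply`, `thetaDistLM_piSBReindex`). [cite: MoeglinVignerasWaldspurger1987, Chap. 2 II.1] -/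
theorem thetaDistLM_omega_seesawSmallLeft₁_symm (p : (adelic F E c N₁ J₁ × adelic F E c N₂ J₂) × adelic F E c M JW)
    (Φ₁ : piSchwartzBruhat F (Fin n₁)) :
    thetaDistLM F (Fin N₁ × Fin M)
      (adelicMpCont.omega F (Fin N₁ × Fin M)
        (T₁.map (algebraMap F (AdeleRing (𝓞 F) F)) ⊗ₖ TW.map (algebraMap F (AdeleRing (𝓞 F) F)))
        (seesawSmallLeft₁ F E c N₁ N₂ M e₁ J₁ J₂ JW s₁ p) ((piSBReindex F e₁).symm Φ₁)) =
      thetaDistLM F (Fin n₁)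
        (adelicMpCont.omega F (Fin n₁) (adelicGram F e₁ T₁ TW) (pairSplitting F E c N₁ M e₁ J₁ JW s₁ (p.1.1, p.2)) Φ₁) := by
  rw [omega_seesawSmallLeft₁_apply, (piSBReindex F e₁).apply_symm_apply, ← thetaDistLM_piSBReindex F e₁,
    (piSBReindex F e₁).apply_symm_apply]

omit [Algebra.IsQuadraticExtension F E] [LocallyCompactSpace (adelic F E c (N₁ + N₂) (finSum N₁ N₂ J₁ J₂))]
  [LocallyCompactSpace (adelic F E c N₁ J₁)] [LocallyCompactSpace (adelic F E c N₂ J₂)]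
  [LocallyCompactSpace (adelic F E c M JW)] in
set_option maxHeartbeats 1600000 in
/-- **small side 2 read through `e₂`**: `Θ_{κ₂}(ω(seesawSmallLeft₂ s₂ p)(R_{e₂}⁻¹Φ₂)) = Θ_{n₂}(ω(s_{2,pair}(p.1.2, p.2)) Φ₂)`. [cite: MoeglinVignerasWaldspurger1987, Chap. 2 II.1] -/
theorem thetaDistLM_omega_seesawSmallLeft₂_symm (p : (adelic F E c N₁ J₁ × adelic F E c N₂ J₂) × adelic F E c M JW)
    (Φ₂ : piSchwartzBruhat F (Fin n₂)) :
    thetaDistLM F (Fin N₂ × Fin M)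
      (adelicMpCont.omega F (Fin N₂ × Fin M)
        (T₂.map (algebraMap F (AdeleRing (𝓞 F) F)) ⊗ₖ TW.map (algebraMap F (AdeleRing (𝓞 F) F)))
        (seesawSmallLeft₂ F E c N₁ N₂ M e₂ J₁ J₂ JW s₂ p) ((piSBReindex F e₂).symm Φ₂)) =
      thetaDistLM F (Fin n₂)
        (adelicMpCont.omega F (Fin n₂) (adelicGram F e₂ T₂ TW) (pairSplitting F E c N₂ M e₂ J₂ JW s₂ (p.1.2, p.2)) Φ₂) := by
  rw [omega_seesawSmallLeft₂_apply, (piSBReindex F e₂).apply_symm_apply, ← thetaDistLM_piSBReindex F e₂,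
    (piSBReindex F e₂).apply_symm_apply]

omit [Algebra.IsQuadraticExtension F E] [LocallyCompactSpace (adelic F E c (N₁ + N₂) (finSum N₁ N₂ J₁ J₂))]
  [LocallyCompactSpace (adelic F E c N₁ J₁)] [LocallyCompactSpace (adelic F E c N₂ J₂)]
  [LocallyCompactSpace (adelic F E c M JW)] in
set_option maxHeartbeats 1600000 in
/-- **big side read through `e_V`**: `Θ_n(ω(s_pair(blockDiag p.1, p.2)) (R_{e_V} Ψ)) = Θ_κ(ω(seesawBigLeft s p) Ψ)`. [cite: MoeglinVignerasWaldspurger1987, Chap. 2 II.1] -/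
theorem thetaDistLM_omega_pairSplitting_blockDiag_piSBReindex
    (p : (adelic F E c N₁ J₁ × adelic F E c N₂ J₂) × adelic F E c M JW) (Ψ : piSchwartzBruhat F (Fin (N₁ + N₂) × Fin M)) :
    thetaDistLM F (Fin n)
        (adelicMpCont.omega F (Fin n) (adelicGram F eV (finSum N₁ N₂ T₁ T₂) TW)
          (pairSplitting F E c (N₁ + N₂) M eV (finSum N₁ N₂ J₁ J₂) JW s (adelicBlockDiag F E c N₁ N₂ J₁ J₂ p.1, p.2))
          (piSBReindex F eV Ψ)) =
      thetaDistLM F (Fin (N₁ + N₂) × Fin M)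
        (adelicMpCont.omega F (Fin (N₁ + N₂) × Fin M)
          ((finSum N₁ N₂ T₁ T₂).map (algebraMap F (AdeleRing (𝓞 F) F)) ⊗ₖ TW.map (algebraMap F (AdeleRing (𝓞 F) F)))
          (seesawBigLeft F E c N₁ N₂ M eV J₁ J₂ JW s p) Ψ) := by
  have hX := congrArg (piSBReindex F eV)
    (omega_seesawBigLeft_apply F E c N₁ N₂ M eV J₁ J₂ JW (T₁ := T₁) (T₂ := T₂) (TW := TW) s p Ψ)
  rw [(piSBReindex F eV).apply_symm_apply] at hX
  rw [← hX, thetaDistLM_piSBReindex]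

/-! ## §2 KERNEL LEVEL -/

omit [LocallyCompactSpace (adelic F E c (N₁ + N₂) (finSum N₁ N₂ J₁ J₂))]
  [LocallyCompactSpace (adelic F E c N₁ J₁)] [LocallyCompactSpace (adelic F E c N₂ J₂)]
  [LocallyCompactSpace (adelic F E c M JW)] in
set_option maxHeartbeats 3200000 in
/-- **The big theta kernel on the V-side block diagonal, unfolded (Weil operators)**: for `p = ((g₁⁻¹, g₂⁻¹), y⁻¹)`,
`Θ_n(ω(s_pair((g₁ ⊕ g₂)⁻¹, y⁻¹)) R_{e_V}(R_{e₁}⁻¹Φ₁ ⊠_{e_Σ} R_{e₂}⁻¹Φ₂)) = χ(p) · Θ_{n₁}(ω(s_{1,pair}(g₁⁻¹, y⁻¹))Φ₁) · Θ_{n₂}(ω(s_{2,pair}(g₂⁻¹, y⁻¹))Φ₂)`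
— A-p09's `thetaDistLM_omega_seesawBigLeft_sumTensor` at `p` read through the three reindex junctions of §1 and `map_inv` on
`adelicBlockDiag` ([Liu2021] display l. 2204–2208 with one term, `χ` explicit). [cite: Liu2021, proof of Thm. 4.15 (FJcycle.tex l. 2199–2210)]
[cite: Kudla1984, §1] -/
theorem thetaDistLM_omega_pairSplitting_blockDiag_sumTensor
    (Φ₁ : piSchwartzBruhat F (Fin n₁)) (Φ₂ : piSchwartzBruhat F (Fin n₂))
    (g₁ : adelic F E c N₁ J₁) (g₂ : adelic F E c N₂ J₂) (y : adelic F E c M JW) :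
    thetaDistLM F (Fin n)
        (adelicMpCont.omega F (Fin n) (adelicGram F eV (finSum N₁ N₂ T₁ T₂) TW)
          (pairSplitting F E c (N₁ + N₂) M eV (finSum N₁ N₂ J₁ J₂) JW s
            ((adelicBlockDiag F E c N₁ N₂ J₁ J₂ (g₁, g₂))⁻¹, y⁻¹))
          (piSBReindex F eV
            (sumTensor F ((finSumFinEquiv.prodCongr (Equiv.refl (Fin M))).symm.trans (Equiv.sumProdDistrib (Fin N₁) (Fin N₂) (Fin M))) ((piSBReindex F e₁).symm Φ₁) ((piSBReindex F e₂).symm Φ₂)))) =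
      (mpSeesawCharLeft F E c N₁ N₂ M eV e₁ e₂ J₁ J₂ JW hcδ hδ hd h₁ h₂ hW h₁d h₂d hWd hVd hJ₁ hJ₂ hJW hs hs₁ hs₂
          ((g₁⁻¹, g₂⁻¹), y⁻¹) : ℂ) *
        (thetaDistLM F (Fin n₁)
            (adelicMpCont.omega F (Fin n₁) (adelicGram F e₁ T₁ TW) (pairSplitting F E c N₁ M e₁ J₁ JW s₁ (g₁⁻¹, y⁻¹)) Φ₁) *
          thetaDistLM F (Fin n₂)
            (adelicMpCont.omega F (Fin n₂) (adelicGram F e₂ T₂ TW) (pairSplitting F E c N₂ M e₂ J₂ JW s₂ (g₂⁻¹, y⁻¹)) Φ₂)) := by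
  have hinv : ((adelicBlockDiag F E c N₁ N₂ J₁ J₂ (g₁, g₂))⁻¹, y⁻¹) =
      (adelicBlockDiag F E c N₁ N₂ J₁ J₂ ((g₁⁻¹, g₂⁻¹), y⁻¹).1, ((g₁⁻¹, g₂⁻¹), y⁻¹).2) := by
    rw [← map_inv]; rfl
  refine (congrArg (fun q => thetaDistLM F (Fin n)
    (adelicMpCont.omega F (Fin n) (adelicGram F eV (finSum N₁ N₂ T₁ T₂) TW)
      (pairSplitting F E c (N₁ + N₂) M eV (finSum N₁ N₂ J₁ J₂) JW s q)
      (piSBReindex F eV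
        (sumTensor F ((finSumFinEquiv.prodCongr (Equiv.refl (Fin M))).symm.trans (Equiv.sumProdDistrib (Fin N₁) (Fin N₂) (Fin M))) ((piSBReindex F e₁).symm Φ₁) ((piSBReindex F e₂).symm Φ₂))))) hinv).trans ?_
  refine (thetaDistLM_omega_pairSplitting_blockDiag_piSBReindex F E c N₁ N₂ M eV J₁ J₂ JW (T₁ := T₁) (T₂ := T₂)
      (TW := TW) (s := s) ((g₁⁻¹, g₂⁻¹), y⁻¹) _).trans ?_
  refine (thetaDistLM_omega_seesawBigLeft_sumTensor F E c N₁ N₂ M eV e₁ e₂ J₁ J₂ JW hcδ hδ hd h₁ h₂ hW h₁d h₂d hWd hVd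
      hJ₁ hJ₂ hJW hs hs₁ hs₂ ((g₁⁻¹, g₂⁻¹), y⁻¹) _ _).trans ?_
  rw [thetaDistLM_omega_seesawSmallLeft₁_symm F E c N₁ N₂ M e₁ J₁ J₂ JW (T₁ := T₁) (TW := TW) (s₁ := s₁)
      ((g₁⁻¹, g₂⁻¹), y⁻¹) Φ₁,
    thetaDistLM_omega_seesawSmallLeft₂_symm F E c N₁ N₂ M e₂ J₁ J₂ JW (T₂ := T₂) (TW := TW) (s₂ := s₂)
      ((g₁⁻¹, g₂⁻¹), y⁻¹) Φ₂]

set_option maxHeartbeats 1600000 in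
/-- **KERNEL LEVEL on the three constructed theta-kernel data**: with `M, M₁, M₂` the data of `UnitaryDualPairThetaKernel` for the big
pair and the two small pairs, `θ_Φ(g₁ ⊕ g₂, y) = χ((g₁⁻¹,g₂⁻¹),y⁻¹) · θ¹_{Φ₁}(g₁, y) · θ²_{Φ₂}(g₂, y)` for
`Φ = R_{e_V}(R_{e₁}⁻¹Φ₁ ⊠_{e_Σ} R_{e₂}⁻¹Φ₂)` (`M.thetaFun Φ (x, h) = Θ(ω(s_pair(x⁻¹, h⁻¹))Φ)`, `thetaKernelDatum_thetaFun_mk` — so this IS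
the previous lemma). [cite: Liu2021, proof of Thm. 4.15 (FJcycle.tex l. 2199–2210)] [cite: Weil1964, Chap. III n° 41 Thm 6 p. 193] -/
theorem thetaFun_blockDiag_sumTensor
    (Φ₁ : piSchwartzBruhat F (Fin n₁)) (Φ₂ : piSchwartzBruhat F (Fin n₂))
    (g₁ : adelic F E c N₁ J₁) (g₂ : adelic F E c N₂ J₂) (y : adelic F E c M JW) :
    (thetaKernelDatum F E c (N₁ + N₂) M eV (finSum N₁ N₂ J₁ J₂) JW hcδ hδ hd (isSymm_finSum h₁ h₂) hW hVd hWd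
        (finSum_eq_map_finSum F E N₁ N₂ J₁ J₂ hJ₁ hJ₂) hJW s hs hρ SK hSK).thetaFun
        (piSBReindex F eV (sumTensor F ((finSumFinEquiv.prodCongr (Equiv.refl (Fin M))).symm.trans (Equiv.sumProdDistrib (Fin N₁) (Fin N₂) (Fin M))) ((piSBReindex F e₁).symm Φ₁) ((piSBReindex F e₂).symm Φ₂)))
        (adelicBlockDiag F E c N₁ N₂ J₁ J₂ (g₁, g₂), y) =
      (mpSeesawCharLeft F E c N₁ N₂ M eV e₁ e₂ J₁ J₂ JW hcδ hδ hd h₁ h₂ hW h₁d h₂d hWd hVd hJ₁ hJ₂ hJW hs hs₁ hs₂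
          ((g₁⁻¹, g₂⁻¹), y⁻¹) : ℂ) *
        ((thetaKernelDatum F E c N₁ M e₁ J₁ JW hcδ hδ hd h₁ hW h₁d hWd hJ₁ hJW s₁ hs₁ hρ₁ SK₁ hSK₁).thetaFun Φ₁ (g₁, y) *
          (thetaKernelDatum F E c N₂ M e₂ J₂ JW hcδ hδ hd h₂ hW h₂d hWd hJ₂ hJW s₂ hs₂ hρ₂ SK₂ hSK₂).thetaFun Φ₂ (g₂, y)) :=
  thetaDistLM_omega_pairSplitting_blockDiag_sumTensor F E c N₁ N₂ M eV e₁ e₂ J₁ J₂ JW hcδ hδ hd h₁ h₂ hW h₁d h₂d hWd hVd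
    hJ₁ hJ₂ hJW hs hs₁ hs₂ Φ₁ Φ₂ g₁ g₂ y

/-! ## §3 LIFT LEVEL: the `g₂`-slice of the restricted big theta lift is a small theta lift with the `g₂`-twisted weight -/

variable [CompactSpace (adelic F E c (N₁ + N₂) (finSum N₁ N₂ J₁ J₂) ⧸ (toAdelic F E c (N₁ + N₂) (finSum N₁ N₂ J₁ J₂)).range)]
  [CompactSpace (adelic F E c N₁ J₁ ⧸ (toAdelic F E c N₁ J₁).range)]
  [CompactSpace (adelic F E c M JW ⧸ (toAdelic F E c M JW).range)]
  [MeasurableSpace (adelic F E c M JW ⧸ (toAdelic F E c M JW).range)]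
  [BorelSpace (adelic F E c M JW ⧸ (toAdelic F E c M JW).range)]
  (μ : Measure (adelic F E c M JW ⧸ (toAdelic F E c M JW).range)) [IsFiniteMeasure μ]

set_option maxHeartbeats 1600000 in
/-- **THE SLICE IDENTITY ([Liu2021] proof of Thm. 4.15: «`V(μ,e)|_ι ⊆ V⋆(μ,e) ⊗ C([U(V⋆^⊥)])`», function level).**  With the
see-saw character trivial (`hχ` — the renormalised small splittings of S2c; [GelbartRogawski1991] Remark p. 457), the restriction to the
V-side block diagonal `(g₁, g₂) ↦ g₁ ⊕ g₂` of the big theta lift ([FleigEtAl2018] (12.37): `Θ_Φ(f)(ξ) = ∫ θ_Φ(ξ, q) f(q) dμ(q)`, read on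
the group by `thetaLiftFun`) of `Φ = R_{e_V}(R_{e₁}⁻¹Φ₁ ⊠_{e_Σ} R_{e₂}⁻¹Φ₂)` against ANY weight `f ∈ C([U(J_W)], ℂ)` is, slice by slice in
`g₂`, the theta lift of `Φ₁` for the small pair `(U(J₁), U(J_W))` against the `g₂`-TWISTED weight `f · θ²_{Φ₂}(g₂⁻¹ΓU₂, ·)`:
`Θ̃_Φ(f)(g₁ ⊕ g₂) = Θ̃¹_{Φ₁}(f · θ²_{Φ₂}(g₂⁻¹ΓU₂, ·))(g₁)`.  Proof: §2 under the integral sign (`thetaLift_apply`, `integral_congr_ae`,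
`QuotientGroup.induction_on`). [cite: Liu2021, proof of Thm. 4.15 (FJcycle.tex l. 2199–2212)] [cite: FleigEtAl2018, §12.3 (12.37)–(12.38)]
[cite: GelbartRogawski1991, §3.1 Remark p. 457] -/
theorem thetaLiftFun_blockDiag_sumTensor
    (hχ : ∀ p, mpSeesawCharLeft F E c N₁ N₂ M eV e₁ e₂ J₁ J₂ JW hcδ hδ hd h₁ h₂ hW h₁d h₂d hWd hVd hJ₁ hJ₂ hJW hs hs₁ hs₂ p = 1)
    (Φ₁ : piSchwartzBruhat F (Fin n₁)) (Φ₂ : piSchwartzBruhat F (Fin n₂))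
    (f : C(adelic F E c M JW ⧸ (toAdelic F E c M JW).range, ℂ))
    (g₁ : adelic F E c N₁ J₁) (g₂ : adelic F E c N₂ J₂) :
    (thetaKernelDatum F E c (N₁ + N₂) M eV (finSum N₁ N₂ J₁ J₂) JW hcδ hδ hd (isSymm_finSum h₁ h₂) hW hVd hWd
        (finSum_eq_map_finSum F E N₁ N₂ J₁ J₂ hJ₁ hJ₂) hJW s hs hρ SK hSK).thetaLiftFun μ
        (piSBReindex F eV (sumTensor F ((finSumFinEquiv.prodCongr (Equiv.refl (Fin M))).symm.trans (Equiv.sumProdDistrib (Fin N₁) (Fin N₂) (Fin M))) ((piSBReindex F e₁).symm Φ₁) ((piSBReindex F e₂).symm Φ₂))) f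
        (adelicBlockDiag F E c N₁ N₂ J₁ J₂ (g₁, g₂)) =
      (thetaKernelDatum F E c N₁ M e₁ J₁ JW hcδ hδ hd h₁ hW h₁d hWd hJ₁ hJW s₁ hs₁ hρ₁ SK₁ hSK₁).thetaLiftFun μ Φ₁
        (f * ((thetaKernelDatum F E c N₂ M e₂ J₂ JW hcδ hδ hd h₂ hW h₂d hWd hJ₂ hJW s₂ hs₂ hρ₂ SK₂ hSK₂).thetaKer Φ₂).curry
          (QuotientGroup.mk g₂⁻¹)) g₁ := by
  rw [ThetaKernelDatum.thetaLiftFun_apply, ThetaKernelDatum.thetaLiftFun_apply, ← map_inv, Prod.inv_mk,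
    ThetaKernelDatum.thetaLift_apply, ThetaKernelDatum.thetaLift_apply]
  refine integral_congr_ae (Filter.Eventually.of_forall fun q => ?_)
  induction q using QuotientGroup.induction_on with
  | H y =>
    simp only [ContinuousMap.mul_apply, ContinuousMap.curry_apply]
    rw [ThetaKernelDatum.thetaKer_mk, ThetaKernelDatum.thetaKer_mk, ThetaKernelDatum.thetaKer_mk]
    have key := thetaFun_blockDiag_sumTensor F E c N₁ N₂ M eV e₁ e₂ J₁ J₂ JW hcδ hδ hd h₁ h₂ hW h₁d h₂d hWd hVd hJ₁ hJ₂
      hJW hs hs₁ hs₂ hρ SK hSK hρ₁ SK₁ hSK₁ hρ₂ SK₂ hSK₂ Φ₁ Φ₂ g₁⁻¹ g₂⁻¹ y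
    rw [hχ, Units.val_one, one_mul] at key
    rw [ThetaKernelDatum.thetaFun_apply, ThetaKernelDatum.thetaFun_apply, ThetaKernelDatum.thetaFun_apply] at key
    rw [key]
    ring

/-! ### Build-lane note (as in `UnitaryDualPairSeesawCharacterLeft`): keep the large dependent telescopes out of the
library-suggestion premise index at `.olean` export. -/
set_option allowUnsafeReducibility true in
attribute [implicit_reducible]
  thetaDistLM_omega_seesawSmallLeft₁_symm thetaDistLM_omega_seesawSmallLeft₂_symm
  thetaDistLM_omega_pairSplitting_blockDiag_piSBReindex thetaDistLM_omega_pairSplitting_blockDiag_sumTensor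
  thetaFun_blockDiag_sumTensor thetaLiftFun_blockDiag_sumTensor

end UnitaryDualPair

end Literature.NumberTheory.GelbartRogawski1991

end
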